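import Literature.MathematicalPhysics.QuantumFieldTheory.Balaban1983to89.B9Ineq346CubeLocalFlatMember
import Literature.MathematicalPhysics.QuantumFieldTheory.Balaban1983to89.B9Ineq347GpFlatMultiLevelTorus

/-!
# `Balaban1983to89.B9Ineq347CubeLocalFlatMember` — [B9] THEOREM 3.1, THE GLOBAL WEIGHTED-SUP ENTRIES (3.47) AT `U = 1` FOR THE CUBE-LOCAL
# LETTER `G′_□`, ALL FOUR MEMBERS, `γ` IN A COMPACT SET — p21's engine «(3.42) + Lemma 2.1 ⇒ (3.47)»
# (`B9Ineq347GpFlatMultiLevelTorus.weighted_sup_of_hasMajorant`, member geometry) at `T := G′_□(1) = GpCubeW` with file 2f's block majorants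
# (sub-row G-B9-LETTERS, module M5.1a, file 2g)

FRAMING (verbatim cell line):
statement-level skeleton of published theorems with citation tags; proofs where landed; nothing here is a claim about the Yang–Mills mass gap

Sources under audit (cell lit-balaban): T. Bałaban, *Propagators for lattice gauge theories in a background field*, Commun. Math. Phys. **99**
(1985) 389–434 [`Balaban1985BackgroundPropagators`, "B9"], Thm 3.1 (3.47) with (3.41) pp. 397–398, Cor. 3.5 p. 407, p. 409 l. 1–5; T. Bałaban,
*Propagators and renormalization transformations for lattice gauge theories. II*, Commun. Math. Phys. **96** (1984) 223–250
[`Balaban1984PropagatorsII`, "[4]"], Prop. 2.2 (2.67), Lemma 2.1 (2.60)–(2.61) p. 234.  Unit `lit-balaban-r05` (r05 gen 77).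

## WHAT IS PRINTED (verbatim up to notation)

[B9] p. 398: «|G′(U)λ|_{(2+γ)}, |∇_UG′(U)λ|_{(1+γ)}, |G′(U)∇*_Uλ|_{(1+γ)}, |Δ_UG′(U)λ|_{(γ)} ≦ B₀|λ|_{(γ)}, (3.47) … for γ in a fixed compact
subset … The global estimates (3.47) are consequences of the local ones (3.42) and Lemma 2.1»; (3.41) p. 397: «|λ|_{(α)} = sup_j sup_{x∈B^j(Λ_j)}
(Lʲη)^{−α}|λ(x)|»; p. 409 l. 1–5: the cube letters «satisfy all the inequalities of Theorems 3.1–3.3».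

## WHAT THIS FILE CERTIFIES (kernel-checked; lattice units; member levels `j(z) = lev_D z`; `G′_□ := GpCubeW D q …`)

**`ineq347_cubeW_member`**: for every real `γ₀` there are `C, M₀ > 0`, `N₀ ≥ 1` (functions of `d, L, γ₀`) such that for every member and cube
(thresholds `M_h ≥ 3`, `L·M_h ≥ M₀`, `R ≥ 2L`, `R·L·M_h ≥ N₀ + 1`, `P ≥ 4`), every `γ` with `|γ| ≤ γ₀`, every `λ` and `N ≥ 0` with
`|λ(z)| ≤ L^{γ j(z)}N`, and every torus point `x`:
`|(G′_□λ)(x)| ≤ C·L^{2j(x)}·L^{γj(x)}·N`, `|(∂_μG′_□λ)(x)|, |(G′_□∂_μᵀλ)(x)| ≤ C·L^{j(x)}·L^{γj(x)}·N`, `|((−Δ^{per})G′_□λ)(x)| ≤ C·L^{γj(x)}·N`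
— i.e. `|G′_□λ|_{(2+γ)}, |∂G′_□λ|_{(1+γ)}, |G′_□∂ᵀλ|_{(1+γ)}, |ΔG′_□λ|_{(γ)} ≤ C|λ|_{(γ)}` in the MEMBER's levels.

## HONEST SCOPE

* `U = 1`; member levels and geometry; cube family of file 1 (mass-`a = a₀ = a₁ = 1` floor).  The reading of (3.41) with member levels is the
  cell's (def-Y `wNormSY`); nothing continuum.
* Nothing is inferred from the manuscript; kernel-checked.  NOT summit progress; the YM mass gap is not proved by any of this.
-/

namespace Literature.MathematicalPhysics.QuantumFieldTheory.Balaban1983to89.B9Ineq347CubeLocalFlatMember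

open Literature.MathematicalPhysics.QuantumFieldTheory.Balaban1983to89.B4Reflection242 (boxDom)
open Literature.MathematicalPhysics.QuantumFieldTheory.Balaban1983to89.B6MultiLevelBoxOperator (N0)
open Literature.MathematicalPhysics.QuantumFieldTheory.Balaban1983to89.B6MultiLevelTorusOperator (perLapT)
open Literature.MathematicalPhysics.QuantumFieldTheory.Balaban1983to89.B6Cover236MultiLevelBlocks (cubes)
open Literature.MathematicalPhysics.QuantumFieldTheory.Balaban1983to89.B6Geom246MultiLevelBox (bset blkOf)
open Literature.MathematicalPhysics.QuantumFieldTheory.Balaban1983to89.B6Geom246MultiLevelTorus (geomT)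
open Literature.MathematicalPhysics.QuantumFieldTheory.Balaban1983to89.B6RandomWalk (HasMajorant hasMajorant_mono)
open Literature.MathematicalPhysics.QuantumFieldTheory.Balaban1983to89.B6Prop22DerivMultiLevelTorus (dT)
open Literature.MathematicalPhysics.QuantumFieldTheory.Balaban1983to89.B6Lemma21Repaired (Ineq261With)
open Literature.MathematicalPhysics.QuantumFieldTheory.Balaban1983to89.B9Thm314GpFlatMultiLevelTorus (consts_260_261)
open Literature.MathematicalPhysics.QuantumFieldTheory.Balaban1983to89.B9Ineq347GpFlatMultiLevelTorus (weighted_sup_of_hasMajorant size_condition)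
open Literature.MathematicalPhysics.QuantumFieldTheory.Balaban1983to89.B9CubeSequence408 (cubeFam)
open Literature.MathematicalPhysics.QuantumFieldTheory.Balaban1983to89.B9Thm31CubeLocalFlat (GpCubeW)
open Literature.MathematicalPhysics.QuantumFieldTheory.Balaban1983to89.B9Ineq346CubeLocalFlatMember (hasMajorant_cubeW_member)
open scoped Matrix

variable {d : ℕ}

/-- **(3.47) AT `U = 1` FOR `G′_□`, ALL FOUR MEMBERS, `γ` IN THE COMPACT SET `[−γ₀, γ₀]`, MEMBER LEVELS.**
[cite: Balaban1985BackgroundPropagators, Thm 3.1 (3.47) with (3.41) pp.397–398, Cor. 3.5 p.407, p.409 l.1–5; Balaban1984PropagatorsII, Prop. 2.2 (2.67) and Lemma 2.1 (2.60)–(2.61) p.234] -/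
theorem ineq347_cubeW_member (d ℓ : ℕ) (hℓ : 1 ≤ ℓ) (γ₀ : ℝ) :
    ∃ C M₀ : ℝ, ∃ N₀ : ℕ, 0 < C ∧ 0 < M₀ ∧ 0 < N₀ ∧
      ∀ {Mh k R : ℕ} {P : Fin (d + 1) → ℕ} (D : B6MultiLevelTorusOperator.TDomains d ℓ Mh k P R)
        (q : ↥(cubes D.toDomains)) (hL : Odd (ℓ + 1)) (hM : Odd Mh) (hMh : 1 ≤ Mh) (hP : ∀ μ, 1 ≤ P μ),
        3 ≤ Mh → M₀ ≤ ((ℓ : ℝ) + 1) * Mh → 2 * (ℓ + 1) ≤ R → N₀ + 1 ≤ R * ((ℓ + 1) * Mh) → (∀ μ, 4 ≤ P μ) →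
      ∀ (γ : ℝ), |γ| ≤ γ₀ → ∀ (lam : ↥(boxDom (N0 ℓ Mh k P)) → ℝ) (N : ℝ), 0 ≤ N →
        (∀ z, |lam z| ≤ ((ℓ : ℝ) + 1) ^ (γ * (D.lev z.1 : ℝ)) * N) →
      ∀ x : ↥(boxDom (N0 ℓ Mh k P)),
        |(GpCubeW D q hL hM hMh hP *ᵥ lam) x|
            ≤ C * ((ℓ : ℝ) + 1) ^ (2 * D.lev x.1) * ((ℓ : ℝ) + 1) ^ (γ * (D.lev x.1 : ℝ)) * N ∧
        (∀ μ : Fin (d + 1), |((dT (N0 ℓ Mh k P) μ * GpCubeW D q hL hM hMh hP) *ᵥ lam) x|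
            ≤ C * ((ℓ : ℝ) + 1) ^ D.lev x.1 * ((ℓ : ℝ) + 1) ^ (γ * (D.lev x.1 : ℝ)) * N) ∧
        (∀ μ : Fin (d + 1), |((GpCubeW D q hL hM hMh hP * (dT (N0 ℓ Mh k P) μ).transpose) *ᵥ lam) x|
            ≤ C * ((ℓ : ℝ) + 1) ^ D.lev x.1 * ((ℓ : ℝ) + 1) ^ (γ * (D.lev x.1 : ℝ)) * N) ∧
        |((perLapT (N0 ℓ Mh k P) * GpCubeW D q hL hM hMh hP) *ᵥ lam) x|
            ≤ C * ((ℓ : ℝ) + 1) ^ (γ * (D.lev x.1 : ℝ)) * N := by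
  obtain ⟨δ, C₀, M₀, N₀, hδ, hC₀, hM₀, hN₀, h⟩ := hasMajorant_cubeW_member d ℓ hℓ
  have hδq : (0 : ℝ) < δ / (⌈γ₀⌉₊ + 1 : ℕ) := by positivity
  obtain ⟨Nq, cq, hNq, -, hconq⟩ := consts_260_261 d ℓ hδq
  obtain ⟨Nc, c, hNc, hc, hcon⟩ := consts_260_261 d ℓ hδ
  have hL0 : (0 : ℝ) < (ℓ : ℝ) + 1 := by positivity
  refine ⟨C₀ * (c + 1) * ((ℓ : ℝ) + 1) ^ γ₀, M₀, max N₀ (max Nq Nc), by positivity, hM₀, lt_of_lt_of_le hN₀ (le_max_left _ _), ?_⟩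
  intro Mh k R P D q hL hM hMh hP h3 hM0 hR hN0 hP4 γ hγ lam N hN hlam x
  have hRN0 : N₀ + 1 ≤ R * ((ℓ + 1) * Mh) := le_trans (Nat.add_le_add_right (le_max_left _ _) 1) hN0
  have hRNq : Nq + 1 ≤ R * ((ℓ + 1) * Mh) := le_trans (Nat.add_le_add_right ((le_max_left _ _).trans (le_max_right _ _)) 1) hN0
  have hRNc : Nc + 1 ≤ R * ((ℓ + 1) * Mh) := le_trans (Nat.add_le_add_right ((le_max_right _ _).trans (le_max_right _ _)) 1) hN0
  have hRMone : 1 ≤ R * ((ℓ + 1) * Mh) := le_trans (by omega) hRNc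
  obtain ⟨hG, hS, hT, hE⟩ := h D q hL hM hMh hP h3 hM0 hR hRN0 hP4
  obtain ⟨hthrq, -⟩ := hconq k Mh R P hMh hP hRNq
  obtain ⟨-, h261⟩ := hcon k Mh R P hMh hP hRNc
  have h261D : Ineq261With c (geomT D) δ (1 / 4) := h261 D
  have hX : 0 ≤ (R : ℝ) * (((ℓ : ℝ) + 1) * Mh) - 1 := by
    have : (1 : ℝ) ≤ (R : ℝ) * (((ℓ : ℝ) + 1) * Mh) := by exact_mod_cast hRMone
    linarith
  have hsize := size_condition (ℓ := ℓ) hδ.le hγ hX hthrq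
  -- constants bookkeeping: `C₀·c·L^{|γ|} ≤ C₀·(c+1)·L^{γ₀}`
  have hLγ : ((ℓ : ℝ) + 1) ^ |γ| ≤ ((ℓ : ℝ) + 1) ^ γ₀ :=
    Real.rpow_le_rpow_of_exponent_le (by linarith [(Nat.cast_nonneg ℓ : (0 : ℝ) ≤ ℓ)]) hγ
  have hfin : ∀ (W : ℝ), 0 ≤ W →
      C₀ * c * ((ℓ : ℝ) + 1) ^ |γ| * W * ((ℓ : ℝ) + 1) ^ (γ * (D.lev x.1 : ℝ)) * N
        ≤ C₀ * (c + 1) * ((ℓ : ℝ) + 1) ^ γ₀ * W * ((ℓ : ℝ) + 1) ^ (γ * (D.lev x.1 : ℝ)) * N := by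
    intro W hW
    have hA : C₀ * c * ((ℓ : ℝ) + 1) ^ |γ| ≤ C₀ * (c + 1) * ((ℓ : ℝ) + 1) ^ γ₀ :=
      mul_le_mul (mul_le_mul_of_nonneg_left (by linarith) hC₀.le) hLγ (Real.rpow_nonneg hL0.le _) (by positivity)
    have hB : 0 ≤ W * ((ℓ : ℝ) + 1) ^ (γ * (D.lev x.1 : ℝ)) * N := by positivity
    calc C₀ * c * ((ℓ : ℝ) + 1) ^ |γ| * W * ((ℓ : ℝ) + 1) ^ (γ * (D.lev x.1 : ℝ)) * N
        = C₀ * c * ((ℓ : ℝ) + 1) ^ |γ| * (W * ((ℓ : ℝ) + 1) ^ (γ * (D.lev x.1 : ℝ)) * N) := by ring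
      _ ≤ C₀ * (c + 1) * ((ℓ : ℝ) + 1) ^ γ₀ * (W * ((ℓ : ℝ) + 1) ^ (γ * (D.lev x.1 : ℝ)) * N) :=
          mul_le_mul_of_nonneg_right hA hB
      _ = _ := by ring
  refine ⟨?_, fun μ => ?_, fun μ => ?_, ?_⟩
  · have hh := weighted_sup_of_hasMajorant D hMh hP hRMone hC₀.le hδ.le hG h261D γ hsize hN hlam x
    exact hh.trans (hfin _ (by positivity))
  · have hS' : HasMajorant (g := geomT D) (blkOf D.toDomains)
        (Matrix.toLin' (dT (N0 ℓ Mh k P) μ * GpCubeW D q hL hM hMh hP))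
        (fun y y' => C₀ * ((ℓ : ℝ) + 1) ^ (1 * y.1.1) * Real.exp (-(δ * (geomT D).dist y y'))) := by
      simpa only [one_mul] using hS μ
    have hh := weighted_sup_of_hasMajorant D hMh hP hRMone hC₀.le hδ.le hS' h261D γ hsize hN hlam x
    rw [one_mul] at hh
    exact hh.trans (hfin _ (by positivity))
  · have hT' : HasMajorant (g := geomT D) (blkOf D.toDomains)
        (Matrix.toLin' (GpCubeW D q hL hM hMh hP * (dT (N0 ℓ Mh k P) μ).transpose))
        (fun y y' => C₀ * ((ℓ : ℝ) + 1) ^ (1 * y.1.1) * Real.exp (-(δ * (geomT D).dist y y'))) := by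
      simpa only [one_mul] using hT μ
    have hh := weighted_sup_of_hasMajorant D hMh hP hRMone hC₀.le hδ.le hT' h261D γ hsize hN hlam x
    rw [one_mul] at hh
    exact hh.trans (hfin _ (by positivity))
  · have hE' : HasMajorant (g := geomT D) (blkOf D.toDomains)
        (Matrix.toLin' (perLapT (N0 ℓ Mh k P) * GpCubeW D q hL hM hMh hP))
        (fun y y' => C₀ * ((ℓ : ℝ) + 1) ^ (0 * y.1.1) * Real.exp (-(δ * (geomT D).dist y y'))) := by
      simpa only [zero_mul, pow_zero, mul_one] using hE
    have hh := weighted_sup_of_hasMajorant D hMh hP hRMone hC₀.le hδ.le hE' h261D γ hsize hN hlam x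
    rw [zero_mul, pow_zero] at hh
    have h' := hfin (1 : ℝ) zero_le_one
    exact hh.trans (by
      calc C₀ * c * ((ℓ : ℝ) + 1) ^ |γ| * 1 * ((ℓ : ℝ) + 1) ^ (γ * (D.lev x.1 : ℝ)) * N
          ≤ C₀ * (c + 1) * ((ℓ : ℝ) + 1) ^ γ₀ * 1 * ((ℓ : ℝ) + 1) ^ (γ * (D.lev x.1 : ℝ)) * N := h'
        _ = _ := by ring)

end Literature.MathematicalPhysics.QuantumFieldTheory.Balaban1983to89.B9Ineq347CubeLocalFlatMember
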